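import Mathlib

/-!
# Route `LacunarySymmetroid` — crux `DoorA26` (stmt-ValiantsHypothesis-19979): the SECANT-LETTER LEMMA
# (a graft polar can vanish on a timelike interval only for an INDEFINITE graft letter)

HONEST FRAMING.  Cell `pub-symmetroid`, seat `val-sym-door-p4` (gen 12); helper file `--supports stmt-ValiantsHypothesis-19979` (`DoorA26`,
OPEN, never asserted).  Kernel anchor of §2 of the seat memo DOOR-A26-P4G12-REPORT («secant grafts»): the cell's DEAD-END LEMMA (i)
(CONJECTURE.md §2.1c: «at a timelike end no compression has external roots») concerns NULL graft letters (compressions = tangent lines of the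
conic); this file records the root-free algebraic fact behind its extension to ALL letters.

For real symmetric `2 × 2` matrices `F, S` write `det F = F₀₀F₁₁ − F₀₁²` and `2·polar(F,S) = F₀₀S₁₁ + F₁₁S₀₀ − 2F₀₁S₀₁` (the polarisation
of `det`, i.e. the Minkowski pairing of `Sym₂(ℝ) ≅ ℝ^{1,2}`).  For a pencil `P(x) = P₅(x) + x^e S` one has
`det P = det P₅ + x^e · 2·polar(P₅, S) + x^{2e} det S` (`det_add_eq`), and the roots a graft letter `S` can add beyond the root span of `det P₅`
are governed by the zeros of the GRAFT POLAR `x ↦ 2·polar(P₅(x), S)` there.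

* `detS_neg_of_polar_eq_zero` — **if `det F > 0` (a timelike point: `P₅(x)` definite) and `S ≠ 0` is polar-orthogonal to `F`, then `det S < 0`**:
  `S` is INDEFINITE (a spacelike letter; its line `S^⊥` is a SECANT of the conic).  Equivalently (`polar_ne_zero_of_detS_nonneg`): a non-zero
  SEMIDEFINITE-or-NULL letter (`det S ≥ 0`) is never polar-orthogonal to a definite matrix — so on a timelike interval of the core the graft polar of
  such a letter has NO zero (the dead-end lemma for null AND definite letters), while an indefinite letter is not excluded (example
  `polar_eq_zero_example`: `F = 1`, `S = diag(1, −1)`).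
* `det_add_eq` — the graft decomposition `det(F + S) = det F + 2·polar(F,S) + det S` (entrywise, `ring`).

[folklore] reverse Cauchy–Schwarz in `ℝ^{1,2}` (a vector Minkowski-orthogonal to a timelike vector is spacelike); `nlinarith`.  No `def`, no `sorry`.
Nothing here bears on `DoorA26` / `DoorA34` (OPEN), the registers, `MatrixDescartes` (stmt-ValiantsHypothesis-18050) or `VP ≠ VNP`.
-/

-- `Summit.ValiantsHypothesis.ValiantsHypothesis.…` repeats a component by the D-0017 layout
-- (single-conjunct summit), which the `dupNamespace` linter flags; the name is mandated.
set_option linter.dupNamespace false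

namespace Summit.ValiantsHypothesis.ValiantsHypothesis.Theorems.LacunarySymmetroid.DoorA26.Inflection

open Matrix

/-- **Graft decomposition** of a `2 × 2` determinant: `det(F + S) = det F + 2·polar(F, S) + det S`, entrywise. [folklore] -/
theorem det_add_eq (F S : Matrix (Fin 2) (Fin 2) ℝ) :
    (F + S) 0 0 * (F + S) 1 1 - (F + S) 0 1 ^ 2 =
      (F 0 0 * F 1 1 - F 0 1 ^ 2) + (F 0 0 * S 1 1 + F 1 1 * S 0 0 - 2 * (F 0 1 * S 0 1)) + (S 0 0 * S 1 1 - S 0 1 ^ 2) := by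
  simp only [Matrix.add_apply]
  ring

/-- **Secant-letter lemma (real form).**  `a c − b² > 0` (a definite matrix `F = [[a,b],[b,c]]`), `(s,t,u) ≠ 0` and
`a u + c s − 2 b t = 0` (polar-orthogonality of `S = [[s,t],[t,u]]` to `F`) force `s u − t² < 0`: the letter `S` is indefinite. [folklore] -/
theorem detS_neg_of_polar_eq_zero_real (a b c s t u : ℝ) (hF : 0 < a * c - b ^ 2) (hS : ¬ (s = 0 ∧ t = 0 ∧ u = 0))
    (h : a * u + c * s - 2 * (b * t) = 0) : s * u - t ^ 2 < 0 := by
  have ha : a ≠ 0 := by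
    intro ha; rw [ha] at hF; nlinarith [sq_nonneg b]
  -- a² (t² − s u) = (a t − b s)² + s² (a c − b²) − a s (a u + c s − 2 b t); with the polar relation the last term vanishes
  have key : a ^ 2 * (t ^ 2 - s * u) = (a * t - b * s) ^ 2 + s ^ 2 * (a * c - b ^ 2) := by
    linear_combination (-(a * s)) * h
  by_contra hcon
  have hcon : 0 ≤ s * u - t ^ 2 := not_lt.mp hcon
  have h1 : a ^ 2 * (t ^ 2 - s * u) ≤ 0 := by
    have : 0 ≤ a ^ 2 := sq_nonneg a
    nlinarith
  have h2 : (a * t - b * s) ^ 2 + s ^ 2 * (a * c - b ^ 2) ≤ 0 := by rw [← key]; exact h1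
  have hs : s = 0 := by
    by_contra hs
    have : 0 < s ^ 2 * (a * c - b ^ 2) := mul_pos (by positivity) hF
    nlinarith [sq_nonneg (a * t - b * s)]
  have ht : t = 0 := by
    rw [hs] at h2
    have : (a * t) ^ 2 ≤ 0 := by nlinarith
    have : a * t = 0 := by nlinarith [sq_nonneg (a * t)]
    rcases mul_eq_zero.mp this with h' | h'
    · exact absurd h' ha
    · exact h'
  have hu : u = 0 := by
    rw [hs, ht] at h
    have : a * u = 0 := by linarith
    rcases mul_eq_zero.mp this with h' | h'
    · exact absurd h' ha
    · exact h'
  exact hS ⟨hs, ht, hu⟩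

/-- **Secant-letter lemma (matrix form).**  If `det F > 0` and the non-zero symmetric letter `S` is polar-orthogonal to `F`
(`F₀₀S₁₁ + F₁₁S₀₀ − 2F₀₁S₀₁ = 0`), then `det S < 0`.  Reading: at a point `x` of a TIMELIKE interval of the core (`det P₅(x) > 0`) the
graft polar `2·polar(P₅(x), S)` vanishes only for an INDEFINITE graft letter `S` (a secant line of the conic). [folklore] -/
theorem detS_neg_of_polar_eq_zero (F S : Matrix (Fin 2) (Fin 2) ℝ) (hF : 0 < F 0 0 * F 1 1 - F 0 1 ^ 2)
    (hS : ¬ (S 0 0 = 0 ∧ S 0 1 = 0 ∧ S 1 1 = 0)) (h : F 0 0 * S 1 1 + F 1 1 * S 0 0 - 2 * (F 0 1 * S 0 1) = 0) :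
    S 0 0 * S 1 1 - S 0 1 ^ 2 < 0 :=
  detS_neg_of_polar_eq_zero_real (F 0 0) (F 0 1) (F 1 1) (S 0 0) (S 0 1) (S 1 1) hF hS h

/-- **Dead end for null and semidefinite letters (root-free form).**  A non-zero letter with `det S ≥ 0` (definite, semidefinite or
null) is never polar-orthogonal to a matrix with `det F > 0`: on a timelike interval of the core its graft polar has no zero. [folklore] -/
theorem polar_ne_zero_of_detS_nonneg (F S : Matrix (Fin 2) (Fin 2) ℝ) (hF : 0 < F 0 0 * F 1 1 - F 0 1 ^ 2)
    (hS : ¬ (S 0 0 = 0 ∧ S 0 1 = 0 ∧ S 1 1 = 0)) (hdet : 0 ≤ S 0 0 * S 1 1 - S 0 1 ^ 2) :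
    F 0 0 * S 1 1 + F 1 1 * S 0 0 - 2 * (F 0 1 * S 0 1) ≠ 0 := fun h =>
  absurd (detS_neg_of_polar_eq_zero F S hF hS h) (not_lt.mpr hdet)

/-- **Indefinite letters are not excluded**: `F = 1` (definite) and `S = diag(1, −1)` (indefinite) are polar-orthogonal. [folklore] -/
theorem polar_eq_zero_example :
    (1 : Matrix (Fin 2) (Fin 2) ℝ) 0 0 * (!![1, 0; 0, -1] : Matrix (Fin 2) (Fin 2) ℝ) 1 1 +
      (1 : Matrix (Fin 2) (Fin 2) ℝ) 1 1 * (!![1, 0; 0, -1] : Matrix (Fin 2) (Fin 2) ℝ) 0 0 -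
      2 * ((1 : Matrix (Fin 2) (Fin 2) ℝ) 0 1 * (!![1, 0; 0, -1] : Matrix (Fin 2) (Fin 2) ℝ) 0 1) = 0 := by
  simp

/-- **Pencil reading.**  For a core `P : ℝ → Matrix (Fin 2) (Fin 2) ℝ` (any matrix-valued function, e.g. `x ↦ Σ_l x^{d_l} S_l`) and a
non-zero graft letter `S` with `det S ≥ 0`: at every point where `det P(x) > 0` the graft polar `2·polar(P(x), S)` is non-zero — its zeros lie
in the closure of the spacelike set of the core.  Only an indefinite letter can place graft-polar zeros on a timelike interval. [folklore] -/
theorem graftPolar_ne_zero_on_timelike (P : ℝ → Matrix (Fin 2) (Fin 2) ℝ) (S : Matrix (Fin 2) (Fin 2) ℝ)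
    (hS : ¬ (S 0 0 = 0 ∧ S 0 1 = 0 ∧ S 1 1 = 0)) (hdet : 0 ≤ S 0 0 * S 1 1 - S 0 1 ^ 2)
    (x : ℝ) (hx : 0 < P x 0 0 * P x 1 1 - P x 0 1 ^ 2) :
    P x 0 0 * S 1 1 + P x 1 1 * S 0 0 - 2 * (P x 0 1 * S 0 1) ≠ 0 :=
  polar_ne_zero_of_detS_nonneg (P x) S hx hS hdet

end Summit.ValiantsHypothesis.ValiantsHypothesis.Theorems.LacunarySymmetroid.DoorA26.Inflection
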